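import Mathlib
import Literature.NumberTheory.Transcendental.KZCalculus
import Literature.NumberTheory.Transcendental.KZLogCalculusProofs
import Summits.KontsevichZagierPeriods.KontsevichZagierPeriods.Theorems.TorsionLogsNeronTorsionSectorStubHaarReps
import Summits.KontsevichZagierPeriods.KontsevichZagierPeriods.Theorems.TorsionLogsNeronTorsionSectorStubFibreNL
import Summits.KontsevichZagierPeriods.KontsevichZagierPeriods.Theorems.TorsionLogsNeronTorsionSectorStubDlogUnfoldAux
import Summits.KontsevichZagierPeriods.KontsevichZagierPeriods.Theorems.HyperbolicBlochOffTetraSectorKernelRungZeroLogRelations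
import HarnessLib

/-!
# Stub `stub_rIReduction` — crux `TorsionLogs.NeronTorsionSector`, line `registered` (block V7):
# Step 0, the exact Newton–Leibniz reduction of `rI`

On the identity component `x > e₁ > 0` of the real curve `y² = f(x) = 4x³ − g₂x − g₃` (algebraic
coefficients, `f(e₁) = 0`, `f > 0` beyond `e₁`) consider, on the triangle
`T = {e₁ < x′ < x < x_P}` (`z 0 = x`, `z 1 = x′`), the crux's first representation
`rI = [T, x′ dx dx′/(√f(x)√f(x′))]` and the second-kind representation
`HT = [T, h(x′) dx dx′/(√f(x)√f(x′))]`, `h(x) = (g₂x + 2g₃)/(4x²)`. Since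
`f′(x)x − 2f(x) = 4x³ + g₂x + 2g₃`, one has `d/dx′ (√f(x′)/(2x′)) = (x′ + h(x′))/√f(x′)`, and we prove
that `[rI] + [HT]` is ONE interval log carrier modulo `KZ.relations`:

1. integrand additivity (rule (1b)): `[rS] − [rI] − [HT] ∈ relations` for the sum representation
   `rS = [T, (x′ + h(x′))/(√f(x)√f(x′))]` (constructed by `stub_haarReps`);
2. one fibrewise Newton–Leibniz move (`stub_fibreNL`, fibres `(e₁, x)` over the base `(e₁, x_P)`,
   potential `Q(x′) = −√f(x′)/(2x′)`, `Q(e₁) = 0`): `[rS] ≡ [(e₁, x_P), (√f(x)/(2x))/√f(x) dx]`;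
3. the change of variables `t = √(x/e₁)` (rule (2), `of_sub_of_mem_relations_of_cov_fin_one`,
   Jacobian `1/(2√(e₁x))`) onto the log carrier `[(1, √(x_P/e₁)), dt/t]` of `exists_logRep`.

References: M. Kontsevich, D. Zagier, *Periods* (2001), §1.2 rules (1)–(3); J. Bochnak, M. Coste,
M.-F. Roy, *Real Algebraic Geometry* (1998), Prop. 2.2.6.
-/

noncomputable section

-- `Summit.KontsevichZagierPeriods.KontsevichZagierPeriods.…` is the tree's mandated layout (single-conjunct summit).
set_option linter.dupNamespace false

open Set MeasureTheory MvPolynomial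
open Literature.NumberTheory.Transcendental Literature.ModelTheory.ExponentialFields
open Summit.KontsevichZagierPeriods.HyperbolicBloch.OffTetraSectorKernel (exists_logRep
  isSemialgebraic_logIvl)

namespace Summit.KontsevichZagierPeriods.KontsevichZagierPeriods.Cruxes.NeronTorsionSector.Translation

/-- **The potential `Q(x) = −√f(x)/(2x)` has derivative `−(x + h(x))/√f(x)`**, where
`h(x) = (g₂x + 2g₃)/(4x²)` and `f(x) = 4x³ − g₂x − g₃ > 0`, `x > 0`: indeed
`f′(x)x − 2f(x) = 4x³ + g₂x + 2g₃` (`Real.hasDerivAt_sqrt`, quotient rule).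
[cite: KontsevichZagier2001, §1.2 rule (3)] -/
theorem rIRed_hasDerivAt_Q {g₂ g₃ x : ℝ} {f : ℝ → ℝ} (hf : ∀ x, f x = 4 * x ^ 3 - g₂ * x - g₃)
    (hx : 0 < x) (hfx : 0 < f x) :
    HasDerivAt (fun y => -Real.sqrt (f y) / (2 * y))
      (-((x + (g₂ * x + 2 * g₃) / (4 * x ^ 2)) / Real.sqrt (f x))) x := by
  have hfeq : f = fun y => 4 * y ^ 3 - g₂ * y - g₃ := funext hf
  have h3 : HasDerivAt (fun y : ℝ => y ^ 3) (3 * x ^ 2) x := by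
    simpa using hasDerivAt_pow 3 x
  have hf' : HasDerivAt f (12 * x ^ 2 - g₂) x := by
    rw [hfeq]
    exact (((h3.const_mul 4).sub ((hasDerivAt_id' x).const_mul g₂)).sub_const g₃).congr_deriv
      (by ring)
  have hsq : HasDerivAt (fun y => Real.sqrt (f y)) ((12 * x ^ 2 - g₂) / (2 * Real.sqrt (f x))) x :=
    hf'.sqrt hfx.ne'
  have hden : HasDerivAt (fun y : ℝ => 2 * y) 2 x := by
    simpa using (hasDerivAt_id' x).const_mul (2 : ℝ)
  have h := hsq.fun_neg.fun_div hden (mul_ne_zero two_ne_zero hx.ne')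
  refine h.congr_deriv ?_
  set s : ℝ := Real.sqrt (f x) with hs
  have hs0 : s ≠ 0 := (Real.sqrt_pos.2 hfx).ne'
  have hs2 : s ^ 2 = 4 * x ^ 3 - g₂ * x - g₃ := by rw [hs, Real.sq_sqrt hfx.le, hf]
  field_simp
  linear_combination 8 * hs2

/-- **The Jacobian identity of `t = √(x/e₁)`**: with `s = √(x/e₁) > 0`,
`(1/s) · |(1/e₁)/(2s)| = 1/(2x)`. [cite: KontsevichZagier2001, §1.2 rule (2)] -/
theorem rIRed_jacobian {e₁ x s : ℝ} (he : 0 < e₁) (hx : 0 < x) (hs : 0 < s)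
    (hs2 : s ^ 2 = x / e₁) : 1 / s * |1 / e₁ / (2 * s)| = 1 / (2 * x) := by
  rw [abs_of_pos (by positivity)]
  field_simp
  rw [hs2]
  field_simp

/-- **A bound for the sum density** `x + h(x)`, `h(x) = (g₂x + 2g₃)/(4x²)`, on `(e₁, x_P)`
(`e₁ > 0`): `|x + h(x)| ≤ x_P + (|g₂|x_P + 2|g₃|)/(4e₁²)`. [folklore] -/
theorem rIRed_abs_k_le {g₂ g₃ e₁ xP x : ℝ} (he : 0 < e₁) (hx : e₁ < x) (hxP : x < xP) :
    |x + (g₂ * x + 2 * g₃) / (4 * x ^ 2)| ≤ xP + (|g₂| * xP + 2 * |g₃|) / (4 * e₁ ^ 2) := by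
  have hx0 : 0 < x := he.trans hx
  have hxle : x ≤ xP := hxP.le
  have hxP0 : 0 < xP := hx0.trans_le hxle
  have h4x : 0 < 4 * x ^ 2 := by positivity
  calc |x + (g₂ * x + 2 * g₃) / (4 * x ^ 2)|
      ≤ |x| + |(g₂ * x + 2 * g₃) / (4 * x ^ 2)| := abs_add_le _ _
    _ = x + |g₂ * x + 2 * g₃| / (4 * x ^ 2) := by rw [abs_of_pos hx0, abs_div, abs_of_pos h4x]
    _ ≤ xP + (|g₂| * xP + 2 * |g₃|) / (4 * e₁ ^ 2) := by
        have hnum : |g₂ * x + 2 * g₃| ≤ |g₂| * xP + 2 * |g₃| := by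
          calc |g₂ * x + 2 * g₃| ≤ |g₂ * x| + |2 * g₃| := abs_add_le _ _
            _ = |g₂| * x + 2 * |g₃| := by rw [abs_mul, abs_of_pos hx0, abs_mul, abs_two]
            _ ≤ |g₂| * xP + 2 * |g₃| := by gcongr
        have hden : 4 * e₁ ^ 2 ≤ 4 * x ^ 2 := by gcongr
        have key := div_le_div₀ (by positivity) hnum (by positivity) hden
        linarith

/-- **A bound for the base density** `√f(x)/(2x)` on `(e₁, x_P)` (`e₁ > 0`,
`f = 4x³ − g₂x − g₃`): `|√f(x)/(2x)| ≤ √(4x_P³ + |g₂|x_P + |g₃|)/(2e₁)`. [folklore] -/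
theorem rIRed_abs_base_le {g₂ g₃ e₁ xP x : ℝ} {f : ℝ → ℝ}
    (hf : ∀ x, f x = 4 * x ^ 3 - g₂ * x - g₃) (he : 0 < e₁) (hx : e₁ < x) (hxP : x < xP) :
    |Real.sqrt (f x) / (2 * x)| ≤ Real.sqrt (4 * xP ^ 3 + |g₂| * xP + |g₃|) / (2 * e₁) := by
  have hx0 : 0 < x := he.trans hx
  have hxle : x ≤ xP := hxP.le
  have hfx : f x ≤ 4 * xP ^ 3 + |g₂| * xP + |g₃| := by
    rw [hf]
    have h1 : x ^ 3 ≤ xP ^ 3 := by gcongr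
    have h2 : -(g₂ * x) ≤ |g₂| * xP := by
      calc -(g₂ * x) ≤ |g₂ * x| := neg_le_abs _
        _ = |g₂| * x := by rw [abs_mul, abs_of_pos hx0]
        _ ≤ |g₂| * xP := by gcongr
    have h3 : -g₃ ≤ |g₃| := neg_le_abs _
    linarith
  rw [abs_div, abs_of_nonneg (Real.sqrt_nonneg _), abs_of_pos (by positivity : (0 : ℝ) < 2 * x)]
  exact div_le_div₀ (Real.sqrt_nonneg _) (Real.sqrt_le_sqrt hfx) (by positivity) (by linarith)

/-- The closed half-line slab `{t | e₁ ≤ t 0} ⊆ ℝ¹` with real-algebraic `e₁` is `ℚ`-semialgebraic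
(the locus where the `ℚ`-semialgebraic function `t 0 − e₁` is non-negative).
[cite: BochnakCosteRoy1998, Prop. 2.2.6] -/
theorem rIRed_isSemialgebraic_slab_Ici {e₁ : ℝ} (he₁ : IsAlgebraic ℚ e₁) :
    IsSemialgebraic ℚ {t : Fin 1 → ℝ | t 0 ∈ Set.Ici e₁} := by
  have hU : IsSemialgebraic ℚ (univ : Set (Fin 1 → ℝ)) := isSemialgebraic_univ
  have hX : IsSemialgebraicFunOn ℚ (univ : Set (Fin 1 → ℝ)) (fun p => p 0) :=
    (isSemialgebraicFunOn_aeval hU (X 0)).congr fun p _ => by simp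
  have h := (IsSemialgebraicFunOn.sub_holds hX
    (isSemialgebraicFunOn_const_of_isAlgebraic hU he₁)).isSemialgebraic_sep_nonneg
  convert h using 1
  ext t
  simp [sub_nonneg]

/-- **STUB V7 (`stub_rIReduction`) — Step 0: the exact Newton–Leibniz reduction of `rI`.** Since
`x′/√f(x′) + h(x′)/√f(x′) = d/dx′ (√f(x′)/(2x′))` (`h = (g₂x + 2g₃)/(4x²)`), one fibre move (`stub_fibreNL` over
the base `(e₁, x_P)` with fibres `(e₁, x)`, primitive `−√f(x′)/(2x′)`, vanishing at `e₁`) gives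
`[T, (x′ + h(x′))/(√f√f′)] ≡ [(e₁, x_P), dx/(2x)]`, and the change of variables `t = √(x/e₁)`
(`of_sub_of_mem_relations_of_cov_fin_one`) turns the latter into the log carrier `[(1, √(x_P/e₁)), dt/t]`.
Hence `[rI] + [ℍ(T)] ≡ [(1, √(x_P/e₁)), dt/t]`. [cite: KontsevichZagier2001, §1.2 rules (2),(3)] -/
theorem stub_rIReduction : ∀ (g₂ g₃ e₁ xP : ℝ) (f : ℝ → ℝ) (rI HT : Literature.NumberTheory.Transcendental.KZ.IntegralRep 2),
    (∀ x, f x = 4 * x ^ 3 - g₂ * x - g₃) → f e₁ = 0 → 0 < e₁ → (∀ x, e₁ < x → 0 < f x) → e₁ < xP →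
    IsAlgebraic ℚ g₂ → IsAlgebraic ℚ g₃ → IsAlgebraic ℚ e₁ → IsAlgebraic ℚ xP →
    MeasureTheory.IntegrableOn (fun t => (Real.sqrt (f t))⁻¹) (Set.Ioi e₁) →
    rI.domain = {z | e₁ < z 1 ∧ z 1 < z 0 ∧ z 0 < xP} →
    Set.EqOn rI.integrand (fun z => z 1 / (Real.sqrt (f (z 1)) * Real.sqrt (f (z 0)))) rI.domain →
    HT.domain = {z | e₁ < z 1 ∧ z 1 < z 0 ∧ z 0 < xP} →
    Set.EqOn HT.integrand
      (fun z => (g₂ * z 1 + 2 * g₃) / (4 * (z 1) ^ 2) / (Real.sqrt (f (z 0)) * Real.sqrt (f (z 1)))) HT.domain →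
    ∃ rB : Literature.NumberTheory.Transcendental.KZ.IntegralRep 1,
      rB.domain = {t | 1 < t 0 ∧ t 0 < Real.sqrt (xP / e₁)} ∧
      Set.EqOn rB.integrand (fun t => 1 / t 0) rB.domain ∧
      Literature.NumberTheory.Transcendental.KZ.of rI + Literature.NumberTheory.Transcendental.KZ.of HT
        - Literature.NumberTheory.Transcendental.KZ.of rB ∈ Literature.NumberTheory.Transcendental.KZ.relations := by
  intro g₂ g₃ e₁ xP f rI HT hf hfe₁ he₁pos hpos hxP h₂ h₃ he₁ hxPalg hint hId hIi hHd hHi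
  ---------------------------------------------------------------------------------------------
  -- (0) basic facts, the base interval `A = (e₁, x_P)` and its slab, the auxiliary functions
  ---------------------------------------------------------------------------------------------
  have hxP0 : 0 < xP := he₁pos.trans hxP
  have hfc : Continuous f := by
    rw [show f = fun x => 4 * x ^ 3 - g₂ * x - g₃ from funext hf]
    fun_prop
  have hAsa : IsSemialgebraic ℚ {t : Fin 1 → ℝ | t 0 ∈ Ioo e₁ xP} := isSemialgebraic_logIvl he₁ hxPalg
  have hX0 : IsSemialgebraicFunOn ℚ {t : Fin 1 → ℝ | t 0 ∈ Ioo e₁ xP} (fun t => t 0) :=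
    (isSemialgebraicFunOn_aeval hAsa (X 0)).congr fun t _ => by simp
  -- the sum density `k = x + h(x)`, the potential `Q = -√f/(2x)`, the base density `√f/(2x)`,
  -- the change of variables `G = √(x/e₁)` and its derivative
  obtain ⟨k, hk⟩ : ∃ k : ℝ → ℝ, k = fun x => x + (g₂ * x + 2 * g₃) / (4 * x ^ 2) := ⟨_, rfl⟩
  obtain ⟨Q, hQ⟩ : ∃ Q : ℝ → ℝ, Q = fun x => -Real.sqrt (f x) / (2 * x) := ⟨_, rfl⟩
  obtain ⟨gB, hgB⟩ : ∃ gB : ℝ → ℝ, gB = fun x => Real.sqrt (f x) / (2 * x) := ⟨_, rfl⟩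
  obtain ⟨G, hG⟩ : ∃ G : ℝ → ℝ, G = fun x => Real.sqrt (x / e₁) := ⟨_, rfl⟩
  obtain ⟨G', hG'⟩ : ∃ G' : ℝ → ℝ, G' = fun x => 1 / e₁ / (2 * Real.sqrt (x / e₁)) := ⟨_, rfl⟩
  ---------------------------------------------------------------------------------------------
  -- (1) the sum representation `rS = [T, k(x′)/(√f(x)√f(x′))]` and rule (1b)
  ---------------------------------------------------------------------------------------------
  have hk_sa : IsSemialgebraicFunOn ℚ {t : Fin 1 → ℝ | t 0 ∈ Ioo e₁ xP} (fun t => k (t 0)) := by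
    have hc₂ := isSemialgebraicFunOn_const_of_isAlgebraic hAsa h₂
    have hc₃ := isSemialgebraicFunOn_const_of_isAlgebraic hAsa ((isAlgebraic_nat 2).mul h₃)
    have hden : IsSemialgebraicFunOn ℚ {t : Fin 1 → ℝ | t 0 ∈ Ioo e₁ xP} (fun t => 4 * t 0 ^ 2) :=
      (isSemialgebraicFunOn_aeval hAsa (C 4 * X 0 ^ 2)).congr fun t _ => by simp
    have hnum : IsSemialgebraicFunOn ℚ {t : Fin 1 → ℝ | t 0 ∈ Ioo e₁ xP}
        (fun t => g₂ * t 0 + 2 * g₃) :=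
      (IsSemialgebraicFunOn.add_holds (IsSemialgebraicFunOn.mul_holds hc₂ hX0) hc₃).congr
        fun t _ => by simp
    have hq := hnum.div hden fun t ht =>
      mul_ne_zero four_ne_zero (pow_ne_zero 2 (he₁pos.trans ht.1).ne')
    exact (IsSemialgebraicFunOn.add_holds hX0 hq).congr fun t _ => by simp [hk]
  have hk_c : ContinuousOn k (Ioo e₁ xP) := by
    rw [hk]
    refine continuousOn_id.add (ContinuousOn.div (by fun_prop) (by fun_prop) fun x hx => ?_)
    exact mul_ne_zero four_ne_zero (pow_ne_zero 2 (he₁pos.trans hx.1).ne')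
  have hk_M : ∀ x ∈ Ioo e₁ xP, |k x| ≤ xP + (|g₂| * xP + 2 * |g₃|) / (4 * e₁ ^ 2) := by
    intro x hx
    rw [hk]
    exact rIRed_abs_k_le he₁pos hx.1 hx.2
  have hTsub : rI.domain ⊆ {z : Fin 2 → ℝ | e₁ < z 0 ∧ z 1 ∈ Ioo e₁ xP} := by
    rw [hId]
    rintro z ⟨h1, h2, h3⟩
    exact ⟨h1.trans h2, h1, h2.trans h3⟩
  obtain ⟨rS, hSd, hSi⟩ := stub_haarReps.2 g₂ g₃ e₁ _ f k (Ioo e₁ xP) rI.domain h₂ h₃ he₁ hf hpos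
    hint Ioo_subset_Ioi_self hAsa hk_sa hk_c hk_M rI.isSemialgebraic_domain hTsub
  have ha : KZ.of rS - KZ.of rI - KZ.of HT ∈ KZ.relations := by
    refine KZ.integrandAddRel_subset_relations ⟨2, rS, rI, HT, hSd.symm, by rw [hHd, hSd, hId],
      fun z hz => ?_, rfl⟩
    have hzI : z ∈ rI.domain := by rwa [hSd] at hz
    have hzH : z ∈ HT.domain := by rwa [hHd, ← hId]
    rw [Pi.add_apply, hSi, hIi hzI, hHi hzH]
    simp only [hk]
    ring
  ---------------------------------------------------------------------------------------------
  -- (2) the base representation `rB₁ = [(e₁, x_P), (√f(x)/(2x))/√f(x) dx]` and rule (3)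
  ---------------------------------------------------------------------------------------------
  have hgB_sa : IsSemialgebraicFunOn ℚ {t : Fin 1 → ℝ | t 0 ∈ Ioo e₁ xP} (fun t => gB (t 0)) := by
    have h2X : IsSemialgebraicFunOn ℚ {t : Fin 1 → ℝ | t 0 ∈ Ioo e₁ xP} (fun t => 2 * t 0) :=
      (isSemialgebraicFunOn_aeval hAsa (C 2 * X 0)).congr fun t _ => by simp
    exact ((isSemialgebraicFunOn_sqrt_cubic_apply hAsa h₂ h₃ hf 0).div h2X fun t ht =>
      mul_ne_zero two_ne_zero (he₁pos.trans ht.1).ne').congr fun t _ => by simp [hgB]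
  have hgB_c : ContinuousOn gB (Ioo e₁ xP) := by
    rw [hgB]
    exact hfc.continuousOn.sqrt.div (continuousOn_const.mul continuousOn_id) fun x hx =>
      mul_ne_zero two_ne_zero (he₁pos.trans hx.1).ne'
  have hgB_M : ∀ x ∈ Ioo e₁ xP, |gB x| ≤ Real.sqrt (4 * xP ^ 3 + |g₂| * xP + |g₃|) / (2 * e₁) := by
    intro x hx
    rw [hgB]
    exact rIRed_abs_base_le hf he₁pos hx.1 hx.2
  obtain ⟨rB₁, hB₁d, hB₁i⟩ := stub_haarReps.1 g₂ g₃ e₁ _ f gB (Ioo e₁ xP) h₂ h₃ he₁ hf hpos hint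
    Ioo_subset_Ioi_self hAsa hgB_sa hgB_c hgB_M
  have hb : KZ.of rS - KZ.of rB₁ ∈ KZ.relations := by
    refine stub_fibreNL g₂ g₃ e₁ f k Q (fun _ => e₁) (fun x => x) (Ioo e₁ xP) (Ici e₁) rS rB₁
      h₂ h₃ he₁ hf hpos Ioo_subset_Ioi_self hAsa (isSemialgebraicFunOn_const_of_isAlgebraic hAsa he₁)
      hX0 (fun x hx => hx.1) (fun x _ y hy => hy.1) Subset.rfl (rIRed_isSemialgebraic_slab_Ici he₁)
      ?_ ?_ ?_ ?_ ?_ hB₁d ?_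
    · -- `Q` is `ℚ`-semialgebraic on the slab over `[e₁, ∞)`
      have hJsa := rIRed_isSemialgebraic_slab_Ici (e₁ := e₁) he₁
      have h2X : IsSemialgebraicFunOn ℚ {t : Fin 1 → ℝ | t 0 ∈ Ici e₁} (fun t => 2 * t 0) :=
        (isSemialgebraicFunOn_aeval hJsa (C 2 * X 0)).congr fun t _ => by simp
      refine (((isSemialgebraicFunOn_sqrt_cubic_apply hJsa h₂ h₃ hf 0).neg).div h2X
        fun t ht => ?_).congr fun t _ => ?_
      · exact mul_ne_zero two_ne_zero (he₁pos.trans_le ht).ne'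
      · simp only [hQ, Pi.neg_apply]
    · -- `Q` is continuous on the closed fibres `[e₁, x]`
      intro x _
      rw [hQ]
      exact (hfc.continuousOn.sqrt.neg).div (continuousOn_const.mul continuousOn_id) fun y hy =>
        mul_ne_zero two_ne_zero (he₁pos.trans_le hy.1).ne'
    · -- `Q′ = -k/√f` on the open fibres `(e₁, x)`
      intro x _ x' hx'
      have hx'0 : 0 < x' := he₁pos.trans hx'.1
      have hfx' : 0 < f x' := hpos x' hx'.1
      rw [hQ, hk]
      exact rIRed_hasDerivAt_Q hf hx'0 hfx'
    · -- the band
      rw [hSd, hId]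
      ext z
      simp only [mem_setOf_eq, mem_Ioo]
      constructor
      · rintro ⟨h1, h2, h3⟩
        exact ⟨⟨h1.trans h2, h3⟩, h1, h2⟩
      · rintro ⟨⟨_, h3⟩, h1, h2⟩
        exact ⟨h1, h2, h3⟩
    · -- the band integrand
      intro z _
      rw [hSi]
    · -- the base integrand: `Q(e₁) = 0` since `f(e₁) = 0`
      intro t _
      rw [hB₁i]
      simp only [hgB, hQ, hfe₁, Real.sqrt_zero, neg_zero, zero_div, zero_sub, neg_div, neg_neg]
  ---------------------------------------------------------------------------------------------
  -- (3) the change of variables `t = √(x/e₁)` onto the log carrier `[(1, √(x_P/e₁)), dt/t]`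
  ---------------------------------------------------------------------------------------------
  have halg : IsAlgebraic ℚ (Real.sqrt (xP / e₁)) := by
    refine IsAlgebraic.of_pow two_pos ?_
    rw [Real.sq_sqrt (div_pos hxP0 he₁pos).le, div_eq_mul_inv]
    exact hxPalg.mul he₁.inv
  obtain ⟨rB, hBd, hBi⟩ := exists_logRep (a := 1) (b := Real.sqrt (xP / e₁)) one_pos
    isAlgebraic_one halg
  have hGmono : StrictMonoOn G (Icc e₁ xP) := by
    intro a ha b _ hab
    rw [hG]
    exact Real.sqrt_lt_sqrt (div_nonneg (he₁pos.le.trans ha.1) he₁pos.le)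
      (div_lt_div_of_pos_right hab he₁pos)
  have hGc : ContinuousOn G (Icc e₁ xP) := by
    rw [hG]
    exact ((continuous_id.div_const e₁).sqrt).continuousOn
  have hG1 : G e₁ = 1 := by
    rw [hG]
    simp [he₁pos.ne']
  have hGxP : G xP = Real.sqrt (xP / e₁) := by rw [hG]
  have hd : KZ.of rB₁ - KZ.of rB ∈ KZ.relations := by
    refine of_sub_of_mem_relations_of_cov_fin_one (G := G) (G' := G') (I := Ioo e₁ xP) rB₁ rB hB₁d
      ?_ ?_ ((hGmono.injOn).mono Ioo_subset_Icc_self) ?_ ?_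
    · -- `G` is `ℚ`-semialgebraic on the slab
      rw [hB₁d, hG]
      exact IsSemialgebraicFunOn.sqrt_holds
        (hX0.div (isSemialgebraicFunOn_const_of_isAlgebraic hAsa he₁) fun t _ => he₁pos.ne')
    · -- `G′`
      intro x hx
      rw [hG, hG']
      exact ((hasDerivAt_id' x).div_const e₁).sqrt (div_pos (he₁pos.trans hx.1) he₁pos).ne'
    · -- the image interval
      rw [hBd, image_Ioo_of_strictMonoOn hxP.le hGc hGmono, hG1, hGxP]
      rfl
    · -- the Jacobian identity `1/(2x) = (1/√(x/e₁)) · |1/(2√(e₁ x))|`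
      intro p hp
      rw [hB₁d] at hp
      have hp' : e₁ < p 0 ∧ p 0 < xP := hp
      have hp0 : 0 < p 0 := he₁pos.trans hp'.1
      have hsf : Real.sqrt (f (p 0)) ≠ 0 := (Real.sqrt_pos.2 (hpos _ hp'.1)).ne'
      have hs : 0 < Real.sqrt (p 0 / e₁) := Real.sqrt_pos.2 (div_pos hp0 he₁pos)
      have hs2 : Real.sqrt (p 0 / e₁) ^ 2 = p 0 / e₁ := Real.sq_sqrt (div_pos hp0 he₁pos).le
      rw [hB₁i, hBi, hgB, hG, hG']
      beta_reduce
      rw [rIRed_jacobian he₁pos hp0 hs hs2]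
      field_simp
  ---------------------------------------------------------------------------------------------
  -- (4) assemble
  ---------------------------------------------------------------------------------------------
  refine ⟨rB, hBd, fun t _ => by rw [hBi], ?_⟩
  have e : KZ.of rI + KZ.of HT - KZ.of rB =
      (KZ.of rS - KZ.of rB₁) + (KZ.of rB₁ - KZ.of rB) - (KZ.of rS - KZ.of rI - KZ.of HT) := by
    abel
  rw [e]
  exact KZ.relations.sub_mem (KZ.relations.add_mem hb hd) ha

end Summit.KontsevichZagierPeriods.KontsevichZagierPeriods.Cruxes.NeronTorsionSector.Translation

end
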